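import Literature.MathematicalPhysics.QuantumFieldTheory.Balaban1983to89.B8SectAStatements
import Literature.MathematicalPhysics.QuantumFieldTheory.Balaban1983to89.MatrixNorms

/-!
# `Balaban1983to89.B8Eq110UnitaryProof` — T. Bałaban, *Spaces of regular gauge field configurations on a lattice and
# gauge fixing conditions*, Commun. Math. Phys. **99** (1985) 75–102 [Balaban1985RegularSpaces]: the remark (1.10)
# «(1.7) may be replaced by (1.10)» PROVED in the unitary matrix model (Phase-2 seat p05, SKELETON row `B8.Eq1.10`)

statement-level skeleton of published theorems with citation tags; proofs where landed; nothing here is a claim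
about the Yang–Mills mass gap

PDF held: `paper:balaban1985-cmp99-regular-spaces-gauge-fixing` (journal page = PDF page + 74); page read for this
file: p. 77 [PDF 3] ((1.7)–(1.10)).

CITATION HEADER / WHAT IS REPRODUCED.  SKELETON row `B8.Eq1.10` (HOME/lit-balaban-r05/ROWS-B8.md), p. 77 verbatim:
*"… |U(∂p) − 1| < α₀L^{−2j} for p ∈ Ω_j, j = 0, 1, …, k, (1.7) … These conditions may be written in many equivalent
ways, for example (1.7) may be replaced by η⁻⁴[1 − Re tr U(∂p)] < α₀²(Lʲη)⁻⁴, p ∈ Ω_j. (1.10)"*.  The statement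
file `B8SectAStatements` (p239704) types (1.7) as `InAkOn Ω k L α₀ U` (:= the k-level conjunction of
`Setup.PlaqSmallOn (Ω j) (α₀(Lʲ)⁻²)`, `|·| = GaugeGroup.dist1`) and (1.10) as `InAkWilson Ω k η L α₀ U`
(`Re tr = GaugeGroup.reTr`, normalized) over the ABSTRACT class `Setup.GaugeGroup`, and records that the asserted
replaceability is a `dist1`–`reTr` comparison the abstract class does not carry.

MODEL INSTANCE (PHASE2-TARGETS §G.3 line p05: "MODEL-INSTANCE for G = U(N) (`UnitaryGroup`)").  In the tree's unitary
model `UnitaryModel` — `dist1 U = ‖U − 1‖` in the L²-OPERATOR norm of `M_N(ℂ)` ([Balaban1985Averaging] (19)),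
`reTr U = Re Tr U / N` ([Balaban1987RG1] (0.2)), instances `instGaugeGroupUnitaryGroup` (U(N)) and
`instGaugeGroupSpecialUnitaryGroup` (SU(N)), and generally `GaugeGroup.ofUnitaryRep H ρ hρ` — this file PROVES,
REUSING the tree's one-matrix comparisons of `MatrixNorms` (B12 (0.14): `nhsNormSq_sub_one_of_mem_unitaryGroup`
`‖U − 1‖²_HS/N = 2(1 − Re tr U)`, hence `two_mul_one_sub_nReTr_le_opDist1_sq` `2(1 − Re tr U) ≤ |U − 1|²_op` and
`opDist1_sq_le_card_mul` `|U − 1|²_op ≤ 2N(1 − Re tr U)`; v1 of this file re-proved the column estimate and was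
bounced `dedup.landed` — nothing of that is re-declared here):
* `wilsonSmallOn_of_plaqSmallOn`, `inAkWilson_of_inAkOn` — over ANY `GaugeGroup G` with the comparison
  `1 − reTr g ≤ (dist1 g)²`: (1.7) ⇒ (1.10) with the SAME α₀ (for `η ≠ 0`; at `η = 0` the typed (1.10) reads `0 < 0`);
  `plaqSmallOn_of_wilsonSmallOn`, `inAkOn_of_inAkWilson` — over any `GaugeGroup G` with `(dist1 g)² ≤ C(1 − reTr g)`,
  `0 < C`: (1.10) ⇒ (1.7) with `α₀ ↦ √C·α₀` (`η ≠ 0`, `0 ≤ α₀`);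
* `inAkWilson_of_inAkOn_unitaryGroup` / `…_specialUnitaryGroup` — **(1.7) ⇒ (1.10) for G = U(N), SU(N), same α₀**;
  `inAkOn_of_inAkWilson_unitaryGroup` / `…_specialUnitaryGroup` — **(1.10) ⇒ (1.7) with α₀ ↦ √(2N)·α₀**.
So print's «may be replaced by» is, in the matrix model with the operator norm of [3] (19) and the normalized trace,
a two-sided implication with the explicit constants `1` and `√(2N)` (the factor print leaves implicit in "α₀").
Nothing beyond p. 77 is asserted; no lattice analysis enters.

Unit `lit-balaban-r05` gen 2 (Phase-2 seat p05 taken by the nominating reader, PHASE2-TARGETS §G.5-4);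
HOME `run/shared/lean/pub/lit-balaban/` (ROWS-B8.md row B8.Eq1.10, FILED.md).
-/

noncomputable section

open scoped BigOperators Matrix.Norms.L2Operator

namespace Literature.MathematicalPhysics.QuantumFieldTheory.Balaban1983to89.B8Eq110UnitaryProof

open Literature.MathematicalPhysics.QuantumFieldTheory.Balaban1983to89
open Literature.MathematicalPhysics.QuantumFieldTheory.Balaban1983to89.B8SectAStatements (WilsonSmallOn InAkWilson
  InAkOn)
open Literature.MathematicalPhysics.QuantumFieldTheory.Balaban1983to89.UnitaryModel (nReTr opDist1)

/-! ## §1 Over an abstract `GaugeGroup` carrying a `dist1`–`reTr` comparison -/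

section Abstract

variable {P : Params} {i : ℕ} {G : Type*} [GaugeGroup G]

/-- (1.7) ⇒ (1.10) on one plaquette set, SAME α₀, for any gauge group with `1 − Re tr g ≤ |g − 1|²`:
`|U(∂p) − 1| < α₀ℓ⁻²` gives `1 − Re tr U(∂p) ≤ |U(∂p) − 1|² < α₀²ℓ⁻⁴`, and multiplying by `η⁻⁴ > 0` is (1.10).
(`η ≠ 0`: at `η = 0` the typed strict inequality (1.10) is `0 < 0`.) [cite: Balaban1985RegularSpaces, (1.10) p.77] -/
theorem wilsonSmallOn_of_plaqSmallOn (hcmp : ∀ g : G, 1 - reTr g ≤ dist1 g ^ 2) {S : Set (Plaq P i)}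
    {η ℓ α₀ : ℝ} (hη : η ≠ 0) {U : GaugeField P i G} (hU : PlaqSmallOn S (α₀ * (ℓ ^ 2)⁻¹) U) :
    WilsonSmallOn S η ℓ α₀ U := by
  intro p hp
  have hd := hU p hp
  set g := GaugeField.plaqHol U p
  have hd0 : 0 ≤ dist1 g := GaugeGroup.dist1_nonneg g
  have hsq : dist1 g ^ 2 < (α₀ * (ℓ ^ 2)⁻¹) ^ 2 := pow_lt_pow_left₀ hd hd0 two_ne_zero
  have hη4 : 0 < (η ^ 4)⁻¹ := by positivity
  have key : 1 - reTr g < α₀ ^ 2 * (ℓ ^ 4)⁻¹ := by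
    calc 1 - reTr g ≤ dist1 g ^ 2 := hcmp g
      _ < (α₀ * (ℓ ^ 2)⁻¹) ^ 2 := hsq
      _ = α₀ ^ 2 * (ℓ ^ 4)⁻¹ := by ring
  calc (η ^ 4)⁻¹ * (1 - reTr g) < (η ^ 4)⁻¹ * (α₀ ^ 2 * (ℓ ^ 4)⁻¹) := mul_lt_mul_of_pos_left key hη4
    _ = α₀ ^ 2 * ((ℓ * η) ^ 4)⁻¹ := by rw [mul_pow, mul_inv]; ring

/-- **(1.7) ⇒ (1.10) for the sequence of domains, same α₀**, for any gauge group with `1 − Re tr g ≤ |g − 1|²`: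
`InAkOn Ω k L α₀ U → InAkWilson Ω k η L α₀ U` (`η ≠ 0`). [cite: Balaban1985RegularSpaces, (1.10) p.77] -/
theorem inAkWilson_of_inAkOn (hcmp : ∀ g : G, 1 - reTr g ≤ dist1 g ^ 2) (Ω : ℕ → Set (Plaq P i)) (k L : ℕ)
    {η : ℝ} (hη : η ≠ 0) (α₀ : ℝ) {U : GaugeField P i G} (hU : InAkOn Ω k L α₀ U) :
    InAkWilson Ω k η L α₀ U :=
  fun j hj => wilsonSmallOn_of_plaqSmallOn hcmp hη (hU j hj)

/-- (1.10) ⇒ (1.7) on one plaquette set with `α₀ ↦ √C·α₀`, for any gauge group with `|g − 1|² ≤ C(1 − Re tr g)`,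
`0 < C`: from (1.10), `1 − Re tr U(∂p) < α₀²ℓ⁻⁴` (multiply by `η⁴ > 0`), so `|U(∂p) − 1|² < Cα₀²ℓ⁻⁴ = (√C·α₀ℓ⁻²)²`.
[cite: Balaban1985RegularSpaces, (1.10) p.77] -/
theorem plaqSmallOn_of_wilsonSmallOn {C : ℝ} (hC : 0 < C) (hcmp : ∀ g : G, dist1 g ^ 2 ≤ C * (1 - reTr g))
    {S : Set (Plaq P i)} {η ℓ α₀ : ℝ} (hη : η ≠ 0) (hα₀ : 0 ≤ α₀) {U : GaugeField P i G}
    (hU : WilsonSmallOn S η ℓ α₀ U) : PlaqSmallOn S (Real.sqrt C * α₀ * (ℓ ^ 2)⁻¹) U := by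
  intro p hp
  have hw := hU p hp
  set g := GaugeField.plaqHol U p
  have hη4 : 0 < η ^ 4 := by positivity
  -- strip the common factor η⁻⁴
  have key : 1 - reTr g < α₀ ^ 2 * (ℓ ^ 4)⁻¹ := by
    have h := mul_lt_mul_of_pos_left hw hη4
    have e1 : η ^ 4 * ((η ^ 4)⁻¹ * (1 - reTr g)) = 1 - reTr g := by
      rw [← mul_assoc, mul_inv_cancel₀ hη4.ne', one_mul]
    have e2 : η ^ 4 * (α₀ ^ 2 * ((ℓ * η) ^ 4)⁻¹) = α₀ ^ 2 * (ℓ ^ 4)⁻¹ := by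
      rw [mul_pow, mul_inv]; field_simp
    rwa [e1, e2] at h
  have hsq : dist1 g ^ 2 < (Real.sqrt C * α₀ * (ℓ ^ 2)⁻¹) ^ 2 := by
    calc dist1 g ^ 2 ≤ C * (1 - reTr g) := hcmp g
      _ < C * (α₀ ^ 2 * (ℓ ^ 4)⁻¹) := mul_lt_mul_of_pos_left key hC
      _ = (Real.sqrt C * α₀ * (ℓ ^ 2)⁻¹) ^ 2 := by
          rw [show (Real.sqrt C * α₀ * (ℓ ^ 2)⁻¹) ^ 2 = Real.sqrt C ^ 2 * (α₀ ^ 2 * (ℓ ^ 4)⁻¹) by ring,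
            Real.sq_sqrt hC.le]
  have hb0 : 0 ≤ Real.sqrt C * α₀ * (ℓ ^ 2)⁻¹ := by positivity
  exact lt_of_pow_lt_pow_left₀ 2 hb0 hsq

/-- **(1.10) ⇒ (1.7) for the sequence of domains with `α₀ ↦ √C·α₀`**, for any gauge group with
`|g − 1|² ≤ C(1 − Re tr g)`, `0 < C`: `InAkWilson Ω k η L α₀ U → InAkOn Ω k L (√C·α₀) U` (`η ≠ 0`, `0 ≤ α₀`).
[cite: Balaban1985RegularSpaces, (1.10) p.77] -/
theorem inAkOn_of_inAkWilson {C : ℝ} (hC : 0 < C) (hcmp : ∀ g : G, dist1 g ^ 2 ≤ C * (1 - reTr g))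
    (Ω : ℕ → Set (Plaq P i)) (k L : ℕ) {η : ℝ} (hη : η ≠ 0) {α₀ : ℝ} (hα₀ : 0 ≤ α₀) {U : GaugeField P i G}
    (hU : InAkWilson Ω k η L α₀ U) : InAkOn Ω k L (Real.sqrt C * α₀) U :=
  fun j hj => plaqSmallOn_of_wilsonSmallOn hC hcmp hη hα₀ (hU j hj)

end Abstract

/-! ## §2 The comparison in the unitary model (from `MatrixNorms`), and the instances U(N), SU(N) -/

section Rep

variable {n : Type*} [Fintype n] [DecidableEq n] [Nonempty n] {H : Type*} [Group H]
  (ρ : H →* Matrix n n ℂ) (hρ : ∀ h, ρ h ∈ Matrix.unitaryGroup n ℂ)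

/-- In the `GaugeGroup` structure induced by a unitary representation `ρ` (`dist1 h = ‖ρ h − 1‖_op`,
`reTr h = Re tr ρ(h)/N`): `1 − reTr h ≤ (dist1 h)²` — indeed `2(1 − Re tr ρh) ≤ |ρh − 1|²`, the tree's
`MatrixNorms.two_mul_one_sub_nReTr_le_opDist1_sq` (B12 (0.14) with `‖·‖_HS/√N ≤ |·|_op`).
[cite: Balaban1985RegularSpaces, (1.10) p.77] -/
theorem cmp_ofUnitaryRep (h : H) :
    1 - (GaugeGroup.ofUnitaryRep H ρ hρ).reTr h ≤ ((GaugeGroup.ofUnitaryRep H ρ hρ).dist1 h) ^ 2 := by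
  show 1 - nReTr (ρ h) ≤ opDist1 (ρ h) ^ 2
  have := MatrixNorms.two_mul_one_sub_nReTr_le_opDist1_sq (hρ h)
  nlinarith [sq_nonneg (opDist1 (ρ h))]

/-- In the same structure: `(dist1 h)² ≤ 2N(1 − reTr h)` — the tree's `MatrixNorms.opDist1_sq_le_card_mul`
(`|·|_op ≤ √N‖·‖_HS/√N·√N`). [cite: Balaban1985RegularSpaces, (1.10) p.77] -/
theorem cmp'_ofUnitaryRep (h : H) :
    ((GaugeGroup.ofUnitaryRep H ρ hρ).dist1 h) ^ 2 ≤
      2 * (Fintype.card n : ℝ) * (1 - (GaugeGroup.ofUnitaryRep H ρ hρ).reTr h) := by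
  show opDist1 (ρ h) ^ 2 ≤ 2 * (Fintype.card n : ℝ) * (1 - nReTr (ρ h))
  have := MatrixNorms.opDist1_sq_le_card_mul (hρ h)
  linarith

end Rep

section Instances

open Literature.MathematicalPhysics.QuantumLattice

variable {P : Params} {i : ℕ} {n : Type*} [DecidableEq n] [Fintype n] [Nonempty n]

/-- `1 − reTr g ≤ (dist1 g)²` on `U(N)` (instance `UnitaryModel.instGaugeGroupUnitaryGroup`).
[cite: Balaban1985RegularSpaces, (1.10) p.77] -/
theorem cmp_unitaryGroup (g : Matrix.unitaryGroup n ℂ) : 1 - reTr g ≤ dist1 g ^ 2 :=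
  cmp_ofUnitaryRep (unitaryFundamentalRep n ℂ) (fun U => U.2) g

/-- `(dist1 g)² ≤ 2N(1 − reTr g)` on `U(N)`. [cite: Balaban1985RegularSpaces, (1.10) p.77] -/
theorem cmp'_unitaryGroup (g : Matrix.unitaryGroup n ℂ) :
    dist1 g ^ 2 ≤ 2 * (Fintype.card n : ℝ) * (1 - reTr g) :=
  cmp'_ofUnitaryRep (unitaryFundamentalRep n ℂ) (fun U => U.2) g

/-- `1 − reTr g ≤ (dist1 g)²` on `SU(N)` (instance `UnitaryModel.instGaugeGroupSpecialUnitaryGroup`).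
[cite: Balaban1985RegularSpaces, (1.10) p.77] -/
theorem cmp_specialUnitaryGroup (g : Matrix.specialUnitaryGroup n ℂ) : 1 - reTr g ≤ dist1 g ^ 2 :=
  cmp_ofUnitaryRep (fundamentalRep n) fundamentalRep_mem_unitaryGroup g

/-- `(dist1 g)² ≤ 2N(1 − reTr g)` on `SU(N)`. [cite: Balaban1985RegularSpaces, (1.10) p.77] -/
theorem cmp'_specialUnitaryGroup (g : Matrix.specialUnitaryGroup n ℂ) :
    dist1 g ^ 2 ≤ 2 * (Fintype.card n : ℝ) * (1 - reTr g) :=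
  cmp'_ofUnitaryRep (fundamentalRep n) fundamentalRep_mem_unitaryGroup g

/-- **(1.7) ⇒ (1.10) for G = U(N), with the SAME α₀** (SKELETON row B8.Eq1.10, the model instance named in
PHASE2-TARGETS §G.3 p05): for a gauge field `U` on the torus with values in `Matrix.unitaryGroup n ℂ`
(`|·| = ‖· − 1‖_op`, `Re tr = Re Tr/N`) and `η ≠ 0`, `InAkOn Ω k L α₀ U → InAkWilson Ω k η L α₀ U` — print's
*"(1.7) may be replaced by (1.10)"*, forward direction. [cite: Balaban1985RegularSpaces, (1.10) p.77] -/
theorem inAkWilson_of_inAkOn_unitaryGroup (Ω : ℕ → Set (Plaq P i)) (k L : ℕ) {η : ℝ} (hη : η ≠ 0) (α₀ : ℝ)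
    {U : GaugeField P i (Matrix.unitaryGroup n ℂ)} (hU : InAkOn Ω k L α₀ U) : InAkWilson Ω k η L α₀ U :=
  inAkWilson_of_inAkOn cmp_unitaryGroup Ω k L hη α₀ hU

/-- **(1.10) ⇒ (1.7) for G = U(N), with `α₀ ↦ √(2N)·α₀`**: `InAkWilson Ω k η L α₀ U → InAkOn Ω k L (√(2N)·α₀) U`
(`η ≠ 0`, `0 ≤ α₀`) — the backward direction of *"may be replaced by"*, with the dimension factor print leaves in α₀.
[cite: Balaban1985RegularSpaces, (1.10) p.77] -/
theorem inAkOn_of_inAkWilson_unitaryGroup (Ω : ℕ → Set (Plaq P i)) (k L : ℕ) {η : ℝ} (hη : η ≠ 0) {α₀ : ℝ}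
    (hα₀ : 0 ≤ α₀) {U : GaugeField P i (Matrix.unitaryGroup n ℂ)} (hU : InAkWilson Ω k η L α₀ U) :
    InAkOn Ω k L (Real.sqrt (2 * (Fintype.card n : ℝ)) * α₀) U :=
  inAkOn_of_inAkWilson (by positivity) cmp'_unitaryGroup Ω k L hη hα₀ hU

/-- (1.7) ⇒ (1.10) for G = SU(N), same α₀ (`η ≠ 0`). [cite: Balaban1985RegularSpaces, (1.10) p.77] -/
theorem inAkWilson_of_inAkOn_specialUnitaryGroup (Ω : ℕ → Set (Plaq P i)) (k L : ℕ) {η : ℝ} (hη : η ≠ 0)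
    (α₀ : ℝ) {U : GaugeField P i (Matrix.specialUnitaryGroup n ℂ)} (hU : InAkOn Ω k L α₀ U) :
    InAkWilson Ω k η L α₀ U :=
  inAkWilson_of_inAkOn cmp_specialUnitaryGroup Ω k L hη α₀ hU

/-- (1.10) ⇒ (1.7) for G = SU(N), `α₀ ↦ √(2N)·α₀` (`η ≠ 0`, `0 ≤ α₀`). [cite: Balaban1985RegularSpaces, (1.10) p.77] -/
theorem inAkOn_of_inAkWilson_specialUnitaryGroup (Ω : ℕ → Set (Plaq P i)) (k L : ℕ) {η : ℝ} (hη : η ≠ 0)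
    {α₀ : ℝ} (hα₀ : 0 ≤ α₀) {U : GaugeField P i (Matrix.specialUnitaryGroup n ℂ)}
    (hU : InAkWilson Ω k η L α₀ U) : InAkOn Ω k L (Real.sqrt (2 * (Fintype.card n : ℝ)) * α₀) U :=
  inAkOn_of_inAkWilson (by positivity) cmp'_specialUnitaryGroup Ω k L hη hα₀ hU

end Instances

end Literature.MathematicalPhysics.QuantumFieldTheory.Balaban1983to89.B8Eq110UnitaryProof
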